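import Summits.HodgeConjecture.HodgeConjecture.Theorems.F0P6aModuliDatumDefs
import Literature.AlgebraicGeometry.AbelianSchemes.AbelianSchemeFibreFrobeniusTwistPolarization
import Literature.AlgebraicGeometry.Motives.GaloisThickeningMovedSheetFrobenius
import Literature.AlgebraicGeometry.AbelianSchemes.SerrePresentationOfKernelLaw
import Literature.AlgebraicGeometry.AbelianSchemes.SerreTensorBaseChange
import Literature.AlgebraicGeometry.AbelianSchemes.CoverFiniteFlatOfSerrePresentation
import Literature.NumberTheory.NumberFields.CMTwistNormCoprimeLevel
import Literature.NumberTheory.NumberFields.CMTwistNormGlueRows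
import Literature.NumberTheory.NumberFields.SerreTensorPresentationOfIdeal
import Summits.HodgeConjecture.HodgeConjecture.Theorems.F0P6aRGDAssemblyDefs
import Literature.AlgebraicGeometry.AbelianSchemes.AbelianSchemeHomReductionSpecialFibreKernel
import Literature.AlgebraicGeometry.AbelianSchemes.RoofLegsSpecialFibre
import Summits.HodgeConjecture.HodgeConjecture.Theorems.F0P6aStubFROBCoverTailBridge   -- ED. v3 («M-138b» DEAL L3-D6): §5 reads ★ (ν8k) ED. 2 through the two-theorem currency bridge
import HarnessLib

/-!
# `F0P6aStubFROBCoverTail` — ★ RE-HOME of the crux workfile `Lines/F0_P6a_StubFROBCover.lean` (tree sha16 c25aa22579fadd09, 398 l., 5 declaration commands, code-`sorry`-free), PART 1 of 2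

This `Theorems/` module is the TREE BYTES of that workfile with the NAMESPACE KEPT, so every fully-qualified name is UNCHANGED; only this module docstring is re-headed,
the `Lines` imports are switched to their ★ re-homed twins — `Lines.F0_P6a_ModuliDatumDefs` → ★ `Theorems.F0P6aModuliDatumDefs`; `Lines.F0_P6a_RGDAssembly` → ★ `Theorems.F0P6aRGDAssemblyDefs` — and the audit carrier `LibrarySuggestionsDenyListCruxes` is dropped (it stays in the `Lines/` shim).
Why a re-home: a `Theorems/` file cannot import a `Lines/` workfile (F0P6-ref1 o-6), and closing stmt-HodgeConjecture-24832 `--as proved --by <Theorems decl>` at rung 0 needs the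
sorry-free `Lines` chain behind the gate (RE-HOME TABLE v1.7, LA7-plan (g7); PLAN «L3 cone RE-HOME» v1, LA3-plan (g5); LEAD F0P6-plan (g5) «M-140» (1)∕(4), 2026-09-02).
SIZE LINT (`Theorems/` files with proofs ≤ 400 l.): the workfile is cut into 2 consecutive parts `F0P6aStubFROBCoverTail` → `F0P6aStubFROBCover`; this is PART 1 (tree lines :1–:376); each later part imports the previous one and re-opens the scopes open at its cut with their `variable`∕`open`∕`set_option` lines replayed verbatim; the LAST part `F0P6aStubFROBCover` is the module the `Lines/` shim and consumers import.
After the chain is ★ the `Lines` workfile becomes a one-import SHIM of `F0P6aStubFROBCover` (a `Lines/` write, batched per cone on the LEAD՚s word), so no environment holds two copies (NO-CROSS-IMPORT).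
It asserts nothing beyond what the workfile already proves.  HC_CM is proved only modulo the 7 printed citations (2 remaining: hLiu418 = stmt-HodgeConjecture-24832, h413 = stmt-HodgeConjecture-24833) until rung 0 closes; a re-home is count-neutral.

## Original module docstring (verbatim)
# `stub_COV0` PAID ON ROAD (δ): the Frobenius cover of the reduction, from the reduced cover `c̄` and its rows
(Lines leaflet `Cruxes/HLiu418/Lines/F0_P6a_StubCOV0.lean` — sorry-free capital; cell `hodgecm-mathlib`, F0∕P6 line L3, socket `stub_FROB` ▸ organ `stub_COV0`; author LA3-p02 (g0) — road (δ): tail, head, glue;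
(ν8k) seam + budget LA3-p01 (g2); dealer LA3-plan (g0) rulings (R1) 03:30:21Z, «COV0 PAYMENT» 04:53:39Z.)  THEOREMS ONLY, Defs ED. 3 currency (`sch₀Of`, `act₀Of`,
`pol₀Of`, `dual₀Of`, `lvlPt₀Of`, `FrobCover₀`; `schΩOf`, `actΩOf`, …).  §1 TAIL `frobCover₀_of_movedCover` (a cover into the Frobenius-MOVED fibre `A_{x̄″}`, `x̄″ = x̄ ≫ F̃`,
IS a `FrobCover₀ … x̄′ x̄`: one `obtain` on the ★ (d3) junction `J : A_{x̄″} ≅ A_x̄^{(q)}`); §3 HEAD `frobCover₀_of_reducedCover` (from the REDUCED cover `c̄` and its rows; no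
Serre family, no `Db`); §4 `cov0_of_reductionRows` (the `stub_COV0` statement modulo the reduction-with-kernel contract (ν8k) as ONE named hypothesis); §5 CLOSER
`reductionRows_of_coverRows` (the contract, by ★ (ν8k) ED. 2 `exists_specialFibre_hom_reduction_ker_ringAction` read through the Defs `rfl`s) and
**`cov0_of_inputs (I) : ‹stub_COV0 statement›` with NO extra hypothesis** — the pen writes `stub_COV0 I := cov0_of_inputs I`.
HC_CM is proved only modulo the 2 remaining named inputs (hLiu418 24832, h413 24833) until rung 0 closes; written by `ledger crux write` on the LEAD heir's word (writer A-p06 (g34) by rights), count-neutral.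
-/

set_option autoImplicit false
set_option linter.dupNamespace false

noncomputable section

namespace Summit.HodgeConjecture.HodgeConjecture.Cruxes.HLiu418.F0P6aStubFROBCover

open CategoryTheory CategoryTheory.Limits AlgebraicGeometry NumberField IsDedekindDomain
open scoped MonObj CategoryTheory.Obj Matrix
open Literature.AlgebraicGeometry.Motives (AlgPoints IntegralModel SchemeOver frobeniusOver relFrobeniusOver frobSpec)
open Literature.NumberTheory.DiophantineGeometry (geomResidueField specResidueField)
open Literature.AlgebraicGeometry.AbelianSchemes Literature.AlgebraicGeometry.AbelianSchemes.AbelianSchemeOver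
open Summit.HodgeConjecture.HodgeConjecture.Cruxes.HLiu418.F0P6aModuliDatumDefs
open Literature.NumberTheory.GaloisRepresentations
open Literature.NumberTheory.Automorphic Literature.NumberTheory.Automorphic.UnitaryGroup
open Literature.AlgebraicGeometry.ShimuraVarieties.UnitaryCanonicalModel
open Literature.NumberTheory.Automorphic.Liu2021.AppendixC
open Literature.AlgebraicGeometry.Motives (thickening thickeningLift)

section Tail

variable {F : Type} [Field F] [NumberField F] [IsCMField F] {X : SchemeOver F}
    (𝓜 : IntegralModel (𝓞 F) F X) (w : HeightOneSpectrum (𝓞 F))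
    (𝒜 : AbelianSchemeOver (𝓜.localise w).total.left) (ρ : RingAction (𝓞 F) 𝒜)
    (D : 𝒜.DualPair) (pol : 𝒜.Polarization D) {g N : ℕ} (lvl : 𝒜.LevelStructure g N)
    (pChar fDeg : ℕ) [ExpChar (geomResidueField w) pChar]

-- as Defs ED. 3 and ★ (d3): `sch₀Of`∕`fibre₀Of` group structures agree only above `instances` transparency (local to the tail; the head's `hγ` coercion must not see it)
set_option backward.isDefEq.respectTransparency false in
/-- **THE TAIL OF ROAD A: A COVER INTO THE FROBENIUS-MOVED FIBRE IS A `FrobCover₀`.**  For special points `x̄′, x̄, x̄″` of `𝓨_s` with `x̄″ = x̄ ≫ F̃` and a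
homomorphism `u : A_{x̄′} → A_{x̄″}` (iterated base changes `sch₀Of`) with (f1) the Serre presentation of `𝔞` against `ι_{x̄′}`, `ι_{x̄″}`, (f1′) kernel `A_{x̄′}[𝔞]` on
all `T`-points and `u` surjective, (f3) `u ≫ λ_{x̄″} ≫ u^∨ = λ_{x̄′} ≫ [n]`, (f4) `ι`-equivariance, (f5) `u(σ^a(x̄′)) = σ^a(x̄″)`: `FrobCover₀ 𝓜 w 𝒜 ρ D pol lvl p f 𝔞 n x̄′ x̄`
(the cover is `u ≫ J` for the ★ (d3) junction `J : A_{x̄″} ≅ A_x̄^{(q)}`). [cite: Shimura1998, §13.1 Thm. 1 (pp. 97–99); §18.6 proof of Thm. 18.6 (p. 127)]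
[cite: SerreTate1968, §1 Lemma 2, Thm 1] -/
theorem frobCover₀_of_movedCover (hq : Nat.card (w.asIdeal.ResidueField) = pChar ^ fDeg) (𝔞 : Ideal (𝓞 F)) (n : ℕ)
    (xbar' xbar xbar'' : AlgPoints (𝓜.localise w).reductionAt (geomResidueField w))
    (hx'' : xbar'' = xbar ≫ frobeniusOver (𝓜.localise w).reductionAt)
    (u : (sch₀Of 𝓜 w 𝒜 xbar').X ⟶ (sch₀Of 𝓜 w 𝒜 xbar'').X) [IsMonHom u]
    (h1 : ∀ a ∈ 𝔞, ∃ d : (sch₀Of 𝓜 w 𝒜 xbar'').X ⟶ (sch₀Of 𝓜 w 𝒜 xbar').X,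
        u ≫ d = (act₀Of 𝓜 w 𝒜 ρ a xbar').hom.hom.hom ∧ d ≫ u = (act₀Of 𝓜 w 𝒜 ρ a xbar'').hom.hom.hom)
    (h1' : ∀ ⦃T : SchemeOver (geomResidueField w)⦄ (t : T ⟶ (sch₀Of 𝓜 w 𝒜 xbar').X),
        t ≫ u = 1 ↔ ∀ a ∈ 𝔞, t ≫ (act₀Of 𝓜 w 𝒜 ρ a xbar').hom.hom.hom = 1)
    (hsurj : Function.Surjective u.left.base)
    (h3 : u ≫ (pol₀Of 𝓜 w 𝒜 pol xbar'').lam ≫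
        Literature.AlgebraicGeometry.AbelianSchemes.AbelianSchemeOver.DualPair.dualIsogenyOver u (dual₀Of 𝓜 w 𝒜 D xbar') (dual₀Of 𝓜 w 𝒜 D xbar'') =
      (pol₀Of 𝓜 w 𝒜 pol xbar').lam ≫ (dual₀Of 𝓜 w 𝒜 D xbar').hat.mulN n)
    (h4 : ∀ a : 𝓞 F, (act₀Of 𝓜 w 𝒜 ρ a xbar').hom.hom.hom ≫ u = u ≫ (act₀Of 𝓜 w 𝒜 ρ a xbar'').hom.hom.hom)
    (h5 : ∀ a : Fin g ⊕ Fin g → ZMod N,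
        AlgPoints.map u (lvlPt₀Of 𝓜 w 𝒜 lvl xbar' a) = lvlPt₀Of 𝓜 w 𝒜 lvl xbar'' a) :
    FrobCover₀ 𝓜 w 𝒜 ρ D pol lvl pChar fDeg 𝔞 n xbar' xbar := by
  have hmon : ∀ a : 𝓞 F, IsMonHom (baseChangeHom (ρ.i a) (pullback.fst (𝓜.localise w).total.hom (specResidueField w))) := fun a => by
    haveI := ρ.isMonHom a
    exact isMonHom_baseChangeHom _ _
  obtain ⟨J, hJ, hJlam, hJnat, hJsec⟩ :=
    (𝒜.baseChange (pullback.fst (𝓜.localise w).total.hom (specResidueField w))).exists_frobeniusTwist_junction pChar fDeg hq xbar hx''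
  haveI := hJ
  have hJsurj : Function.Surjective J.hom.left.base := (Scheme.homeoOfIso ((Over.forget _).mapIso J)).surjective
  refine ⟨u ≫ J.hom, inferInstance, fun a ha => ?_, fun T t => ?_, ?_, ?_, fun a => ?_, fun a => ?_⟩
  · -- (f1) Serre presentation: `d′ := J⁻¹ ≫ d`
    obtain ⟨d, hud, hdu⟩ := h1 a ha
    haveI := hmon a
    refine ⟨J.inv ≫ d, ?_, ?_⟩
    · rw [Category.assoc, J.hom_inv_id_assoc, hud]
    · rw [Category.assoc, ← Category.assoc d, hdu]
      exact (congrArg (J.inv ≫ ·) (hJnat (baseChangeHom (ρ.i a) _))).trans (J.inv_hom_id_assoc _)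
  · -- (f1′) kernel law on all `T`-points
    exact comp_kernel_iff_of_mono u J.hom (fun _ t => ∀ a ∈ 𝔞, t ≫ (act₀Of 𝓜 w 𝒜 ρ a xbar').hom.hom.hom = 1) h1' t
  · -- surjectivity
    rw [Over.comp_left, Scheme.Hom.comp_base, TopCat.coe_comp]
    exact hJsurj.comp hsurj
  · -- (f3) polarisations
    exact comp_lam_comp_dualIsogenyOver_comp_of_exact (dual₀Of 𝓜 w 𝒜 D xbar') (dual₀Of 𝓜 w 𝒜 D xbar'')
      ((dual₀Of 𝓜 w 𝒜 D xbar).baseChange (frobSpec (geomResidueField w) pChar fDeg)) (pol₀Of 𝓜 w 𝒜 pol xbar').lam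
      (pol₀Of 𝓜 w 𝒜 pol xbar'').lam ((pol₀Of 𝓜 w 𝒜 pol xbar).baseChange (frobSpec (geomResidueField w) pChar fDeg)).lam u J.hom n h3
      (hJlam (D.baseChange _) (pol.baseChange _))
  · -- (f4) equivariance
    haveI := hmon a
    rw [← Category.assoc, h4 a, Category.assoc]
    exact (congrArg (u ≫ ·) (hJnat (baseChangeHom (ρ.i a) _))).trans (Category.assoc _ _ _).symm
  · -- (f5) level points
    rw [AlgPoints.map_comp_apply, h5 a]
    exact hJsec ((lvl.baseChange (pullback.fst (𝓜.localise w).total.hom (specResidueField w))).section_ a)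

end Tail

/-! ## §3 ROAD (δ) HEAD (LA3-plan «Q-DUALS-D» ruling (R1), 03:30:21Z): `FrobCover₀` from the REDUCED cover `c̄` and its rows — NO Serre family, NO `Db` -/

section HeadDelta

variable {F : Type} [Field F] [NumberField F] [IsCMField F] {ι₁ : F →+* ℂ} {Jstar : Matrix (Fin 2) (Fin 2) F}
    {K₀ : C5.OpenCompactSubgroup ↥(finAdelic ↥(maximalRealSubfield F) F (IsCMField.complexConj F) 2 Jstar)}
    (S : RecordSystemGS F Jstar ι₁ K₀) {Fi : Type} [Field Fi] [Algebra F Fi] (Kc : C5.SmallLevel K₀)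
    (𝓜 : IntegralModel (𝓞 F) F ((thickening F Fi).obj (S.M.obj Kc))) (w : HeightOneSpectrum (𝓞 F))
    (h𝓨 : (𝓜.localise w).IsSmoothProper 1)
    (e : Fi →ₐ[F] AlgebraicClosure (w.adicCompletion F))
    (𝒜 : AbelianSchemeOver (𝓜.localise w).total.left) (ρ : RingAction (𝓞 F) 𝒜) [IsCommMonObj 𝒜.X]
    (D : 𝒜.DualPair) (pol : 𝒜.Polarization D) {g N' : ℕ} (lvl : 𝒜.LevelStructure g N')
    (pChar fDeg : ℕ) [ExpChar (geomResidueField w) pChar]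
    {m : ℕ} (E' : Matrix (Fin m) (Fin m) (𝓞 F)) (hE' : E' * E' = E') (P : Matrix (Fin m) (Fin 1) (𝓞 F)) (Q : Matrix (Fin 1) (Fin m) (𝓞 F)) {N : ℕ}

include hE' in
/-- **ROAD (δ) HEAD — THE FROBENIUS COVER OF THE REDUCTION FROM THE REDUCED COVER `c̄ : A_{red₀(σ•y)} → A_{red_{e∘γ}(σ•y)}` AND ITS ROWS** (LA3-plan ruling (R1) 03:30:21Z:
both ends are `𝒜`-fibres, no Serre family, no dual pair of a Serre tensor).  INPUT ROWS = the output of ★ (ν8) `exists_specialFibre_hom_reduction` on the generic cover `c` of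
`CoverKerΩ … (σ • y)` between the model points `ℓ_e(σ•y)`, `ℓ_{e∘γ}(σ•y)` — (i) `c̄` surjective, (ii) (f4) equivariance, (iii) (f5) level points, (iv) (f3) polarisations with scalar
`n` — PLUS the kernel row (ν8k)(v′) «`Ker c̄ = A[𝔞]` on all `T`-points» (LA3-p01), all written in the Defs ED. 3 currency at `x̄′ := red₀Of … e (σ • y)`, `x̄″ := red₀Of … (e ∘ γ) (σ • y)`,
and a Serre presentation `(E′, P, Q, N)` of `𝔞` (`N ≠ 0`; only to run ★ p848676).  INSIDE: `x̄″ = red₀ y ≫ F̃` (★ p847680), (f1) from (f1′)+(f4)+surjectivity (★ A-p03 p848676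
`exists_twoSided_presentation_of_comp_eq_one_iff_forall_mem`), then the tail `frobCover₀_of_movedCover` (★ (d3) junction).
[cite: Shimura1998, §13.1 Thm. 1 (pp. 97–99); §18.6 proof of Thm. 18.6 (p. 127)] [cite: SerreTate1968, §1 Lemma 2, Thm 1] [cite: MumfordAV1970, §7 Thm. 4 (p. 72)] -/
theorem frobCover₀_of_reducedCover (hN : N ≠ 0) (hP : E' * P = P) (hQ : Q * E' = Q)
    (hQP : Q * P = Matrix.scalar (Fin 1) (N : 𝓞 F)) (hPQ : P * Q = Matrix.scalar (Fin m) (N : 𝓞 F) * E')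
    {𝔞 : Ideal (𝓞 F)} (h𝔞 : Ideal.span (Set.range fun k => P k 0) = 𝔞) (n : ℕ)
    (hq : Nat.card (w.asIdeal.ResidueField) = pChar ^ fDeg)
    {σ : Field.absoluteGaloisGroup (w.adicCompletion F)} (hσ : IsAbsArithFrob σ) (gam : Fi ≃ₐ[F] Fi)
    (hγ : ((AlgEquiv.restrictScalars F (Field.absoluteGaloisGroup.toAlgEquiv (w.adicCompletion F) σ) :
        AlgebraicClosure (w.adicCompletion F) ≃ₐ[F] AlgebraicClosure (w.adicCompletion F)) :
        AlgebraicClosure (w.adicCompletion F) →ₐ[F] AlgebraicClosure (w.adicCompletion F)).comp e = e.comp (gam : Fi →ₐ[F] Fi))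
    (y : AlgPoints (S.M.obj Kc) (AlgebraicClosure (w.adicCompletion F)))
    (ubar : (sch₀Of 𝓜 w 𝒜 (red₀Of S Kc 𝓜 w h𝓨 e (σ • y))).X ⟶ (sch₀Of 𝓜 w 𝒜 (red₀Of S Kc 𝓜 w h𝓨 (e.comp (gam : Fi →ₐ[F] Fi)) (σ • y))).X)
    [IsMonHom ubar] (hsurj : Function.Surjective ubar.left.base)
    (h1' : ∀ ⦃T : SchemeOver (geomResidueField w)⦄ (t : T ⟶ (sch₀Of 𝓜 w 𝒜 (red₀Of S Kc 𝓜 w h𝓨 e (σ • y))).X),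
        t ≫ ubar = 1 ↔ ∀ a ∈ 𝔞, t ≫ (act₀Of 𝓜 w 𝒜 ρ a (red₀Of S Kc 𝓜 w h𝓨 e (σ • y))).hom.hom.hom = 1)
    (h3 : ubar ≫ (pol₀Of 𝓜 w 𝒜 pol (red₀Of S Kc 𝓜 w h𝓨 (e.comp (gam : Fi →ₐ[F] Fi)) (σ • y))).lam ≫
        Literature.AlgebraicGeometry.AbelianSchemes.AbelianSchemeOver.DualPair.dualIsogenyOver ubar
          (dual₀Of 𝓜 w 𝒜 D (red₀Of S Kc 𝓜 w h𝓨 e (σ • y))) (dual₀Of 𝓜 w 𝒜 D (red₀Of S Kc 𝓜 w h𝓨 (e.comp (gam : Fi →ₐ[F] Fi)) (σ • y))) =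
      (pol₀Of 𝓜 w 𝒜 pol (red₀Of S Kc 𝓜 w h𝓨 e (σ • y))).lam ≫ (dual₀Of 𝓜 w 𝒜 D (red₀Of S Kc 𝓜 w h𝓨 e (σ • y))).hat.mulN n)
    (h4 : ∀ a : 𝓞 F, (act₀Of 𝓜 w 𝒜 ρ a (red₀Of S Kc 𝓜 w h𝓨 e (σ • y))).hom.hom.hom ≫ ubar =
        ubar ≫ (act₀Of 𝓜 w 𝒜 ρ a (red₀Of S Kc 𝓜 w h𝓨 (e.comp (gam : Fi →ₐ[F] Fi)) (σ • y))).hom.hom.hom)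
    (h5 : ∀ a : Fin g ⊕ Fin g → ZMod N',
        AlgPoints.map ubar (lvlPt₀Of 𝓜 w 𝒜 lvl (red₀Of S Kc 𝓜 w h𝓨 e (σ • y)) a) =
          lvlPt₀Of 𝓜 w 𝒜 lvl (red₀Of S Kc 𝓜 w h𝓨 (e.comp (gam : Fi →ₐ[F] Fi)) (σ • y)) a) :
    FrobCover₀ 𝓜 w 𝒜 ρ D pol lvl pChar fDeg 𝔞 n (red₀Of S Kc 𝓜 w h𝓨 e (σ • y)) (red₀Of S Kc 𝓜 w h𝓨 e y) := by
  haveI : IsProper (𝓜.localise w).total.hom := h𝓨.2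
  haveI : IsCommMonObj (𝒜.baseChange (pullback.fst (𝓜.localise w).total.hom (specResidueField w))).X := isCommMonObj_baseChange _
  have hx'' : red₀Of S Kc 𝓜 w h𝓨 (e.comp (gam : Fi →ₐ[F] Fi)) (σ • y) = red₀Of S Kc 𝓜 w h𝓨 e y ≫ frobeniusOver (𝓜.localise w).reductionAt :=
    (𝓜.localise w).geomReductionMap_thickeningLift_comp_smul_eq_comp_frobeniusOver (S.M.obj Kc) hσ e gam hγ y
  -- (f1) from (f1′) + (f4) + surjectivity (★ p848676), read ONCE at generic special points `x′ x″` (atoms) and then instantiated at the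
  -- `red₀Of …` carriers by first-order matching — the fibre∕base-change dictionary is never unfolded under the carriers (heartbeats 366 257 → 59 586, LA3-p01 (g7) profile 2026-09-03)
  have key : ∀ (x' x'' : AlgPoints (𝓜.localise w).reductionAt (geomResidueField w))
      (u : (sch₀Of 𝓜 w 𝒜 x').X ⟶ (sch₀Of 𝓜 w 𝒜 x'').X) [IsMonHom u], Function.Surjective u.left.base →
      (∀ ⦃T : SchemeOver (geomResidueField w)⦄ (t : T ⟶ (sch₀Of 𝓜 w 𝒜 x').X),
          t ≫ u = 1 ↔ ∀ a ∈ 𝔞, t ≫ (act₀Of 𝓜 w 𝒜 ρ a x').hom.hom.hom = 1) →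
      (∀ a : 𝓞 F, (act₀Of 𝓜 w 𝒜 ρ a x').hom.hom.hom ≫ u = u ≫ (act₀Of 𝓜 w 𝒜 ρ a x'').hom.hom.hom) →
      ∀ a ∈ 𝔞, ∃ d : (sch₀Of 𝓜 w 𝒜 x'').X ⟶ (sch₀Of 𝓜 w 𝒜 x').X,
        u ≫ d = (act₀Of 𝓜 w 𝒜 ρ a x').hom.hom.hom ∧ d ≫ u = (act₀Of 𝓜 w 𝒜 ρ a x'').hom.hom.hom := by
    intro x' x'' u _ hs hk he
    have hComm : IsCommMonObj (sch₀Of 𝓜 w 𝒜 x').X := isCommMonObj_baseChange _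
    exact @exists_twoSided_presentation_of_comp_eq_one_iff_forall_mem (geomResidueField w) _ _ (sch₀Of 𝓜 w 𝒜 x') (sch₀Of 𝓜 w 𝒜 x'')
      (𝓞 F) _ ((ρ.baseChange (pullback.fst (𝓜.localise w).total.hom (specResidueField w))).baseChange x'.left)
      ((ρ.baseChange (pullback.fst (𝓜.localise w).total.hom (specResidueField w))).baseChange x''.left)
      hComm _ E' hE' P Q N u inferInstance ⟨hs⟩ hN hP hQ hQP hPQ 𝔞 h𝔞 he hk
  have h1 := key _ _ ubar hsurj h1' h4
  exact frobCover₀_of_movedCover 𝓜 w 𝒜 ρ D pol lvl pChar fDeg hq 𝔞 n (red₀Of S Kc 𝓜 w h𝓨 e (σ • y)) (red₀Of S Kc 𝓜 w h𝓨 e y)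
    (red₀Of S Kc 𝓜 w h𝓨 (e.comp (gam : Fi →ₐ[F] Fi)) (σ • y)) hx'' ubar h1 h1' hsurj h3 h4 h5

end HeadDelta

/-! ## §4 THE `stub_COV0` BODY ON ROAD (δ), MODULO (ν8k) AS ONE NAMED HYPOTHESIS `hν8k` (its D-currency contract; §5 discharges it) -/
section GlueDelta

variable {F : Type} [Field F] [NumberField F] [IsCMField F] [IsGalois ℚ F] {ι₁ : F →+* ℂ}
    {Jstar : Matrix (Fin 2) (Fin 2) F}
    {K₀ : C5.OpenCompactSubgroup ↥(finAdelic ↥(maximalRealSubfield F) F (IsCMField.complexConj F) 2 Jstar)}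
    {S : RecordSystemGS F Jstar ι₁ K₀} {hU7ₛ : S.HeckeTranslateDefinedOver}
    {hJ : (Jstar.map (IsCMField.complexConj F))ᵀ = Jstar} {hJu : IsUnit Jstar}
    {Fi : Type} [Field Fi] [Algebra F Fi] [FiniteDimensional F Fi] [IsGalois F Fi] {Kc : C5.SmallLevel K₀} {G : Type} [Group G] [Finite G]
    {𝓜 : IntegralModel (𝓞 F) F ((thickening F Fi).obj (S.M.obj Kc))}
    {w : HeightOneSpectrum (𝓞 F)} {hw : (IsCMField.complexConj F) • w ≠ w} {h𝓨 : (𝓜.localise w).IsSmoothProper 1}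
    {θ : Literature.AlgebraicGeometry.RelativeSpec.ActionOver (𝓜.localise w).total.hom ((Fi ≃ₐ[F] Fi) × G)}
    {e : Fi →ₐ[F] AlgebraicClosure (w.adicCompletion F)}

omit [FiniteDimensional F Fi] [IsGalois F Fi] [Finite G] in
open Summit.HodgeConjecture.HodgeConjecture.Cruxes.HLiu418.F0P6aRGDAssembly in
set_option maxHeartbeats 400000 in
/-- **REHEARSAL: `stub_COV0` ON ROAD (δ), MODULO THE REDUCTION-WITH-KERNEL ROW (ν8k) AS THE ONE NAMED HYPOTHESIS `hν8k`** (its contract in the D-line currency: for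
sheets `e₁, e₂`, a record point `y₁`, an ideal `𝔞`, `n`, and a FINITE SURJECTIVE homomorphism `u` between the sheet fibres at `y₁` with kernel `A[𝔞]` on all `T`-points,
(t3)∕(t4)∕(t5) rows, there is `ū` between the reductions `red₀ e₁ y₁`, `red₀ e₂ y₁` with surjectivity, the kernel row, (f3)∕(f4)∕(f5) — ★ (ν8) (i)–(iv) + LA3-p01's (v′)).
The conclusion is the `stub_COV0` statement VERBATIM; the body is the one the pen types (presentation with `N := n_γ` ★ `exists_serrePresentation_of_ideal_of_natCast_mem`,
`n_γ ∈ 𝔞_γ`, `n_γ ≠ 0` ★ p848692, row 40 `I.coverKerΩ e γ (σ • y)`, finiteness∕surjectivity of `c` ★ p848853∕p848547, `hq` ★ LA3-p03, then §3 `frobCover₀_of_reducedCover`).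
[cite: Shimura1998, §13.1 Thm. 1 (pp. 97–99); §18.6 (p. 127)] [cite: SerreTate1968, §1 Lemma 2, Thm 1] [cite: MumfordAV1970, §7 Thm. 4 (p. 72)] -/
theorem cov0_of_reductionRows (I : RGDInputsAt F ι₁ Jstar K₀ S hU7ₛ hJ hJu Fi Kc G 𝓜 w hw h𝓨 θ e) [ExpChar (geomResidueField w) I.pChar]
    (hν8k : ∀ (e₁ e₂ : Fi →ₐ[F] AlgebraicClosure (w.adicCompletion F)) (y₁ : AlgPoints (S.M.obj Kc) (AlgebraicClosure (w.adicCompletion F)))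
      (𝔞 : Ideal (𝓞 F)) (n : ℕ) {m : ℕ} (E' : Matrix (Fin m) (Fin m) (𝓞 F)) (_ : E' * E' = E') (P : Matrix (Fin m) (Fin 1) (𝓞 F))
      (Q : Matrix (Fin 1) (Fin m) (𝓞 F)) {N : ℕ}, N ≠ 0 → E' * P = P → Q * E' = Q → Q * P = Matrix.scalar (Fin 1) (N : 𝓞 F) →
      P * Q = Matrix.scalar (Fin m) (N : 𝓞 F) * E' → Ideal.span (Set.range fun k => P k 0) = 𝔞 →
      ∀ (u : (schΩOf S Kc 𝓜 w e₁ I.univ y₁).X ⟶ (schΩOf S Kc 𝓜 w e₂ I.univ y₁).X) [IsMonHom u],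
      IsFinite u.left → Surjective u.left →
      (∀ ⦃T : SchemeOver (AlgebraicClosure (w.adicCompletion F))⦄ (t : T ⟶ (schΩOf S Kc 𝓜 w e₁ I.univ y₁).X),
          t ≫ u = 1 ↔ ∀ a ∈ 𝔞, t ≫ (actΩOf S Kc 𝓜 w e₁ I.univ I.act a y₁).hom.hom.hom = 1) →
      u ≫ (polΩOf S Kc 𝓜 w e₂ I.univ I.pol y₁).lam ≫
          Literature.AlgebraicGeometry.AbelianSchemes.AbelianSchemeOver.DualPair.dualIsogenyOver u
            (dualΩOf S Kc 𝓜 w e₁ I.univ I.dual y₁) (dualΩOf S Kc 𝓜 w e₂ I.univ I.dual y₁) =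
        (polΩOf S Kc 𝓜 w e₁ I.univ I.pol y₁).lam ≫ (dualΩOf S Kc 𝓜 w e₁ I.univ I.dual y₁).hat.mulN n →
      (∀ a : 𝓞 F, (actΩOf S Kc 𝓜 w e₁ I.univ I.act a y₁).hom.hom.hom ≫ u = u ≫ (actΩOf S Kc 𝓜 w e₂ I.univ I.act a y₁).hom.hom.hom) →
      (∀ a : Fin I.g ⊕ Fin I.g → ZMod I.N,
          (AlgPoints.map u (lvlPtΩOf S Kc 𝓜 w e₁ I.univ I.lvl y₁ a) :
              (fibreΩOf S Kc 𝓜 w e₂ I.univ y₁).Points (AlgebraicClosure (w.adicCompletion F))) = lvlPtΩOf S Kc 𝓜 w e₂ I.univ I.lvl y₁ a) →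
      ∃ (ubar : (sch₀Of 𝓜 w I.univ (red₀Of S Kc 𝓜 w h𝓨 e₁ y₁)).X ⟶ (sch₀Of 𝓜 w I.univ (red₀Of S Kc 𝓜 w h𝓨 e₂ y₁)).X) (_ : IsMonHom ubar),
        Function.Surjective ubar.left.base ∧
        (∀ ⦃T : SchemeOver (geomResidueField w)⦄ (t : T ⟶ (sch₀Of 𝓜 w I.univ (red₀Of S Kc 𝓜 w h𝓨 e₁ y₁)).X),
            t ≫ ubar = 1 ↔ ∀ a ∈ 𝔞, t ≫ (act₀Of 𝓜 w I.univ I.act a (red₀Of S Kc 𝓜 w h𝓨 e₁ y₁)).hom.hom.hom = 1) ∧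
        ubar ≫ (pol₀Of 𝓜 w I.univ I.pol (red₀Of S Kc 𝓜 w h𝓨 e₂ y₁)).lam ≫
            Literature.AlgebraicGeometry.AbelianSchemes.AbelianSchemeOver.DualPair.dualIsogenyOver ubar
              (dual₀Of 𝓜 w I.univ I.dual (red₀Of S Kc 𝓜 w h𝓨 e₁ y₁)) (dual₀Of 𝓜 w I.univ I.dual (red₀Of S Kc 𝓜 w h𝓨 e₂ y₁)) =
          (pol₀Of 𝓜 w I.univ I.pol (red₀Of S Kc 𝓜 w h𝓨 e₁ y₁)).lam ≫ (dual₀Of 𝓜 w I.univ I.dual (red₀Of S Kc 𝓜 w h𝓨 e₁ y₁)).hat.mulN n ∧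
        (∀ a : 𝓞 F, (act₀Of 𝓜 w I.univ I.act a (red₀Of S Kc 𝓜 w h𝓨 e₁ y₁)).hom.hom.hom ≫ ubar =
            ubar ≫ (act₀Of 𝓜 w I.univ I.act a (red₀Of S Kc 𝓜 w h𝓨 e₂ y₁)).hom.hom.hom) ∧
        (∀ a : Fin I.g ⊕ Fin I.g → ZMod I.N,
            AlgPoints.map ubar (lvlPt₀Of 𝓜 w I.univ I.lvl (red₀Of S Kc 𝓜 w h𝓨 e₁ y₁) a) =
              lvlPt₀Of 𝓜 w I.univ I.lvl (red₀Of S Kc 𝓜 w h𝓨 e₂ y₁) a)) :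
    ∀ (σ : Field.absoluteGaloisGroup (w.adicCompletion F)), IsAbsArithFrob σ → ∀ gam : Fi ≃ₐ[F] Fi,
      ((AlgEquiv.restrictScalars F (Field.absoluteGaloisGroup.toAlgEquiv (w.adicCompletion F) σ) :
          AlgebraicClosure (w.adicCompletion F) ≃ₐ[F] AlgebraicClosure (w.adicCompletion F)) :
          AlgebraicClosure (w.adicCompletion F) →ₐ[F] AlgebraicClosure (w.adicCompletion F)).comp e = e.comp (gam : Fi →ₐ[F] Fi) →
      ∀ y : AlgPoints (S.M.obj Kc) (AlgebraicClosure (w.adicCompletion F)),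
        FrobCover₀ 𝓜 w I.univ I.act I.dual I.pol I.lvl I.pChar I.fDeg (I.twistIdeal gam) (I.twistNorm gam)
          (red₀Of S Kc 𝓜 w h𝓨 e (σ • y)) (red₀Of S Kc 𝓜 w h𝓨 e y) := by
  intro σ hσ gam hγ y
  haveI : IsCommMonObj I.univ.X := I.comm
  -- the Serre presentation of `𝔞_γ` with the PRESCRIBED scalar `n_γ ∈ 𝔞_γ`
  have hsp := I.twistNorm_spec gam
  have hmem := Literature.NumberTheory.NumberFields.natCast_mem_of_span_eq_mul_complexConj_smul hsp
  have hN := Literature.NumberTheory.NumberFields.ne_zero_of_span_eq_mul_complexConj_smul hsp (I.twistIdeal_ne_bot gam)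
  obtain ⟨m, E', hE', P, Q, hP, hQ, hQP, hPQ, hspan, -⟩ :=
    Literature.NumberTheory.NumberFields.SerrePresentation.exists_serrePresentation_of_ideal_of_natCast_mem (I.twistIdeal gam) (I.twistIdeal_ne_bot gam) hmem
  -- row 40: the generic cover with its kernel law
  obtain ⟨c, hc, h1, hK, -, h3, h4, h5⟩ := I.coverKerΩ e gam (σ • y)
  haveI := hc
  have hfin : IsFinite c.left :=
    -- instance passed explicitly: `hc : IsMonHom c` lives over `Spec Ω̄` spelled `(specOver F Ω̄).left`, invisible to TC at the ★ lemma's spelling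
    @isFinite_left_of_serrePresentation _ _ _ _ _
      ((I.act.baseChange ((𝓜.localise w).genericIso'.inv.left ≫ pullback.fst (𝓜.localise w).total.hom
          (Literature.NumberTheory.EllipticCurves.specGenericPoint (HeightOneSpectrum.valuationSubringAtPrime F w) F))).baseChange
        (thickeningLift e (S.M.obj Kc) (σ • y)).left)
      ((I.act.baseChange ((𝓜.localise w).genericIso'.inv.left ≫ pullback.fst (𝓜.localise w).total.hom
          (Literature.NumberTheory.EllipticCurves.specGenericPoint (HeightOneSpectrum.valuationSubringAtPrime F w) F))).baseChange
        (thickeningLift (e.comp (gam : Fi →ₐ[F] Fi)) (S.M.obj Kc) (σ • y)).left)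
      c hc _ h1 _ hN hmem
  have hcs : Surjective c.left :=
    surjective_left_of_serrePresentation
      ((I.act.baseChange ((𝓜.localise w).genericIso'.inv.left ≫ pullback.fst (𝓜.localise w).total.hom
          (Literature.NumberTheory.EllipticCurves.specGenericPoint (HeightOneSpectrum.valuationSubringAtPrime F w) F))).baseChange
        (thickeningLift (e.comp (gam : Fi →ₐ[F] Fi)) (S.M.obj Kc) (σ • y)).left)
      ((I.act.baseChange ((𝓜.localise w).genericIso'.inv.left ≫ pullback.fst (𝓜.localise w).total.hom
          (Literature.NumberTheory.EllipticCurves.specGenericPoint (HeightOneSpectrum.valuationSubringAtPrime F w) F))).baseChange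
        (thickeningLift e (S.M.obj Kc) (σ • y)).left)
      c h1 hN hmem
  -- (ν8k): reduce `c` with its rows
  obtain ⟨ubar, hmon, hsurj, hv, hiv, hii, hiii⟩ :=
    hν8k e (e.comp (gam : Fi →ₐ[F] Fi)) (σ • y) (I.twistIdeal gam) (I.twistNorm gam) E' hE' P Q hN hP hQ hQP hPQ hspan c hfin hcs hK h3 h4 h5
  haveI := hmon
  exact frobCover₀_of_reducedCover S Kc 𝓜 w h𝓨 e I.univ I.act I.dual I.pol I.lvl I.pChar I.fDeg E' hE' P Q hN hP hQ hQP hPQ hspan (I.twistNorm gam)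
    (Literature.NumberTheory.NumberFields.natCard_residueField_eq_of_natCard_quotient_complexConj_smul w I.hfDeg) hσ gam hγ y ubar hsurj hv hiv hii hiii

end GlueDelta

/-! ## §5 THE CLOSER: the (ν8k)-D contract DISCHARGED by ★ (ν8k) ED. 2 p849382, and `stub_COV0` on road (δ) with NO extra hypothesis -/
section CloserDelta

variable {F : Type} [Field F] [NumberField F] [IsCMField F] [IsGalois ℚ F] {ι₁ : F →+* ℂ}
    {Jstar : Matrix (Fin 2) (Fin 2) F}
    {K₀ : C5.OpenCompactSubgroup ↥(finAdelic ↥(maximalRealSubfield F) F (IsCMField.complexConj F) 2 Jstar)}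
    {S : RecordSystemGS F Jstar ι₁ K₀} {hU7ₛ : S.HeckeTranslateDefinedOver}
    {hJ : (Jstar.map (IsCMField.complexConj F))ᵀ = Jstar} {hJu : IsUnit Jstar}
    {Fi : Type} [Field Fi] [Algebra F Fi] [FiniteDimensional F Fi] [IsGalois F Fi] {Kc : C5.SmallLevel K₀} {G : Type} [Group G] [Finite G]
    {𝓜 : IntegralModel (𝓞 F) F ((thickening F Fi).obj (S.M.obj Kc))}
    {w : HeightOneSpectrum (𝓞 F)} {hw : (IsCMField.complexConj F) • w ≠ w} {h𝓨 : (𝓜.localise w).IsSmoothProper 1}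
    {θ : Literature.AlgebraicGeometry.RelativeSpec.ActionOver (𝓜.localise w).total.hom ((Fi ≃ₐ[F] Fi) × G)}
    {e : Fi →ₐ[F] AlgebraicClosure (w.adicCompletion F)}

omit [FiniteDimensional F Fi] [IsGalois F Fi] [Finite G] in
open Summit.HodgeConjecture.HodgeConjecture.Cruxes.HLiu418.F0P6aRGDAssembly in
/-- **THE (ν8k)-D CONTRACT, DISCHARGED** (★ LA3-p01 p848865 `exists_specialFibre_hom_reduction_ker` read through the Defs ED. 3 `rfl`s): for sheets `e₁, e₂`, a record point
`y₁`, an ideal `𝔞` with Serre presentation `(E′, P, Q, N)`, `n`, and a finite surjective homomorphism `u` between the sheet fibres at `y₁` with kernel `A[𝔞]` on all `T`-points and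
the (t3)∕(t4)∕(t5) rows, there is `ū` between the reductions with surjectivity, the kernel row (f1′), (f3), (f4), (f5).  Currency: `actΩOf`∕`act₀Of` are `fibreHom`s of
`baseChangeHom (ι a) _`, i.e. `((act.baseChange _).baseChange _).i a` (★ `fibreHom_hom_hom_hom`, ★ `RingAction.baseChange_i` — REWRITTEN, not unified); `lvlPtΩOf`∕`lvlPt₀Of` are
restrictions of `(lvl.baseChange _).section_ a = sectionBaseChange _ (σ^a)` (★ `LevelStructure.baseChange_section_`); the unit `1` is typed through `schΩOf`∕`sch₀Of` (base
`Spec κ` spelled as such).  [cite: SerreTate1968, §1 Lemma 2, Thm 1] [cite: MumfordAV1970, §7 Thm. 4 (p. 72), §15 Thm. 1 (p. 143)] -/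
theorem reductionRows_of_coverRows (I : RGDInputsAt F ι₁ Jstar K₀ S hU7ₛ hJ hJu Fi Kc G 𝓜 w hw h𝓨 θ e)
    (e₁ e₂ : Fi →ₐ[F] AlgebraicClosure (w.adicCompletion F)) (y₁ : AlgPoints (S.M.obj Kc) (AlgebraicClosure (w.adicCompletion F)))
    (𝔞 : Ideal (𝓞 F)) (n : ℕ) {m : ℕ} (E' : Matrix (Fin m) (Fin m) (𝓞 F)) (hE' : E' * E' = E') (P : Matrix (Fin m) (Fin 1) (𝓞 F))
    (Q : Matrix (Fin 1) (Fin m) (𝓞 F)) {N : ℕ} (hN : N ≠ 0) (hP : E' * P = P) (hQ : Q * E' = Q) (hQP : Q * P = Matrix.scalar (Fin 1) (N : 𝓞 F))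
    (hPQ : P * Q = Matrix.scalar (Fin m) (N : 𝓞 F) * E') (h𝔞 : Ideal.span (Set.range fun k => P k 0) = 𝔞)
    (u : (schΩOf S Kc 𝓜 w e₁ I.univ y₁).X ⟶ (schΩOf S Kc 𝓜 w e₂ I.univ y₁).X) [IsMonHom u] (hfin : IsFinite u.left) (hsurj : Surjective u.left)
    (hK : ∀ ⦃T : SchemeOver (AlgebraicClosure (w.adicCompletion F))⦄ (t : T ⟶ (schΩOf S Kc 𝓜 w e₁ I.univ y₁).X),
        t ≫ u = 1 ↔ ∀ a ∈ 𝔞, t ≫ (actΩOf S Kc 𝓜 w e₁ I.univ I.act a y₁).hom.hom.hom = 1)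
    (h3 : u ≫ (polΩOf S Kc 𝓜 w e₂ I.univ I.pol y₁).lam ≫
        Literature.AlgebraicGeometry.AbelianSchemes.AbelianSchemeOver.DualPair.dualIsogenyOver u
          (dualΩOf S Kc 𝓜 w e₁ I.univ I.dual y₁) (dualΩOf S Kc 𝓜 w e₂ I.univ I.dual y₁) =
      (polΩOf S Kc 𝓜 w e₁ I.univ I.pol y₁).lam ≫ (dualΩOf S Kc 𝓜 w e₁ I.univ I.dual y₁).hat.mulN n)
    (h4 : ∀ a : 𝓞 F, (actΩOf S Kc 𝓜 w e₁ I.univ I.act a y₁).hom.hom.hom ≫ u = u ≫ (actΩOf S Kc 𝓜 w e₂ I.univ I.act a y₁).hom.hom.hom)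
    (h5 : ∀ a : Fin I.g ⊕ Fin I.g → ZMod I.N,
        (AlgPoints.map u (lvlPtΩOf S Kc 𝓜 w e₁ I.univ I.lvl y₁ a) :
            (fibreΩOf S Kc 𝓜 w e₂ I.univ y₁).Points (AlgebraicClosure (w.adicCompletion F))) = lvlPtΩOf S Kc 𝓜 w e₂ I.univ I.lvl y₁ a) :
    ∃ (ubar : (sch₀Of 𝓜 w I.univ (red₀Of S Kc 𝓜 w h𝓨 e₁ y₁)).X ⟶ (sch₀Of 𝓜 w I.univ (red₀Of S Kc 𝓜 w h𝓨 e₂ y₁)).X) (_ : IsMonHom ubar),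
      Function.Surjective ubar.left.base ∧
      (∀ ⦃T : SchemeOver (geomResidueField w)⦄ (t : T ⟶ (sch₀Of 𝓜 w I.univ (red₀Of S Kc 𝓜 w h𝓨 e₁ y₁)).X),
          t ≫ ubar = 1 ↔ ∀ a ∈ 𝔞, t ≫ (act₀Of 𝓜 w I.univ I.act a (red₀Of S Kc 𝓜 w h𝓨 e₁ y₁)).hom.hom.hom = 1) ∧
      ubar ≫ (pol₀Of 𝓜 w I.univ I.pol (red₀Of S Kc 𝓜 w h𝓨 e₂ y₁)).lam ≫
          Literature.AlgebraicGeometry.AbelianSchemes.AbelianSchemeOver.DualPair.dualIsogenyOver ubar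
            (dual₀Of 𝓜 w I.univ I.dual (red₀Of S Kc 𝓜 w h𝓨 e₁ y₁)) (dual₀Of 𝓜 w I.univ I.dual (red₀Of S Kc 𝓜 w h𝓨 e₂ y₁)) =
        (pol₀Of 𝓜 w I.univ I.pol (red₀Of S Kc 𝓜 w h𝓨 e₁ y₁)).lam ≫ (dual₀Of 𝓜 w I.univ I.dual (red₀Of S Kc 𝓜 w h𝓨 e₁ y₁)).hat.mulN n ∧
      (∀ a : 𝓞 F, (act₀Of 𝓜 w I.univ I.act a (red₀Of S Kc 𝓜 w h𝓨 e₁ y₁)).hom.hom.hom ≫ ubar =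
          ubar ≫ (act₀Of 𝓜 w I.univ I.act a (red₀Of S Kc 𝓜 w h𝓨 e₂ y₁)).hom.hom.hom) ∧
      (∀ a : Fin I.g ⊕ Fin I.g → ZMod I.N,
          AlgPoints.map ubar (lvlPt₀Of 𝓜 w I.univ I.lvl (red₀Of S Kc 𝓜 w h𝓨 e₁ y₁) a) =
            lvlPt₀Of 𝓜 w I.univ I.lvl (red₀Of S Kc 𝓜 w h𝓨 e₂ y₁) a) := by
  -- ED. v3 («M-138b» DEAL L3-D6, LA3-p02 (g9)): the (ν8k) ⇄ D-line currency conversion is paid ONCE in ★ `Theorems/F0P6aStubFROBCoverTailBridge.lean`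
  -- (`reductionRowsStar_of_coverRows` = these hypotheses ⟹ the five ★-currency rows of ★ (ν8k) ED. 2 p849382; `reductionRows_of_reductionRowsStar` = those rows ⟹ this
  -- conclusion); here the two are composed SYNTACTICALLY (HOME census 444 706 → 47 967 heartbeats, the 800 k line dropped).
  exact reductionRows_of_reductionRowsStar I e₁ e₂ y₁ 𝔞 n
    (reductionRowsStar_of_coverRows I e₁ e₂ y₁ 𝔞 n E' hE' P Q hN hP hQ hQP hPQ h𝔞 u hfin hsurj hK h3 h4 h5)


/-! (★ re-home, size lint: PART 1 of 2 ends here at tree line :376; the workfile continues, in the same namespace, in `Theorems/F0P6aStubFROBCover.lean`.) -/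

end CloserDelta
end Summit.HodgeConjecture.HodgeConjecture.Cruxes.HLiu418.F0P6aStubFROBCover
end
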